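import Literature.NumberTheory.Automorphic.ArchRankOneSplitConeMatching            -- ★ (A0-c) group half ED. 1 (p850345): plumbing `hasCompactSupport_comp_coe`, `exists_lineChart_real_isHaarMeasure_map`, `coe_hypBlockGL_zero_left`
import Literature.NumberTheory.Automorphic.ArchRankOneSplitOrbitContinuityJoint     -- ★ (p850218): the JOINT `(x, θ)` head in `K × N` currency
import HarnessLib

/-!
# (A0-c), JOINT FORM: `|eˣ − e⁻ˣ| • ∫_{G ⧸ T} f(↑↑(y · hypBlockGL x θ · y⁻¹)) dμ ⟶ C₂ • [cone⁺(f, e^{iθ₀}) + cone⁻(f, e^{iθ₀})]` as `(x, θ) → (0, θ₀)` within `{x ≠ 0}`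

Topic `NumberTheory/Automorphic`; namespace `Literature.NumberTheory.Automorphic.UnitaryGroup`.  KERNEL mathematics only: theorems, no definition, no named fact,
no instance, no notation, no `sorry`.  Cell `pub/hodgecm-mathlib`, line LH3 (closer stub `stub_N9`, crux H413 = `stmt-HodgeConjecture-24833`), DIRECT ROAD brick **(A0-c)
JOINT** (pen F0P3a-p05 (g19); LH10-p02 (g4) 2026-09-02T07:55:32Z «(A0-DOCKED-JOINT)»: the `hA0` slot of ★ `stOrbFamH_insert_cayPt_eq_mul_prod` and the `hcH` constant
of ★ `ArchBouazizStableFamilyJumpZero{,Product}` read the split-place value as a limit along the LOCAL TRIPLE `(x, θ₁, θ) → (0, ·, θ₀)`, i.e. jointly in `(x, θ)`).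

THE MATHEMATICS.  Identical to ★ ED. 1 `exists_tendsto_abs_sub_smul_integral_descConj_hypBlockGL_cone` (circle `K₁`, `κ = (k_s)_* ds`, `μ_N = (n_{iu})_* du`, ★ FILE 1
constant `C`, `C₂ = 2C`), with the JOINT `K × N`-currency head ★ `tendsto_abs_sub_smul_integral_descConj_hypBlockGL_joint` in place of the `x`-only one and the same
cone matching ★ `integral_addCircle_prod_coneChart_eq_two_smul_cone` at `z = e^{iθ₀}`.  ONE `C₂ > 0` (depending on `μ` only) serves every `f` and every wall point `θ₀`.
HONEST LABEL: HC_CM is proved only modulo the 7 printed citations (2 remaining: hLiu418 = stmt-HodgeConjecture-24832, h413 = stmt-HodgeConjecture-24833) until rung 0 closes;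
measure theory over Mathlib + ★ kit, count-neutral, pays nothing by itself.

## References
* [Varadarajan1989] V. S. Varadarajan, *An Introduction to Harmonic Analysis on Semisimple Lie Groups*, Cambridge Stud. Adv. Math. 16 (1989), §6.4 Lemma 21, Thm 23.
* [Shelstad1979] D. Shelstad, *Characters and inner forms of a quasi-split group over ℝ*, Compositio Math. 39 (1979), Lemma 4.3 p. 25.
* [Rogawski1990] J. D. Rogawski, *Automorphic Representations of Unitary Groups in Three Variables*, Ann. of Math. Stud. 123 (1990), §3.1 p. 19, §8.2 pp. 119, 122. -/

set_option autoImplicit false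

noncomputable section

open MeasureTheory Measure Set Filter Topology
open scoped ENNReal NNReal ComplexConjugate Real MatrixGroups Matrix

namespace Literature.NumberTheory.Automorphic

open Literature.MeasureTheory.Group

namespace UnitaryGroup

open Literature.NumberTheory.Rogawski1990
open Literature.NumberTheory.Automorphic.UnitaryGroup.HeisRing Literature.NumberTheory.Automorphic.UnitaryGroup.LineRing

section ConeMatchingJoint

variable {J : Matrix (Fin 2) (Fin 2) ℂ} (hJ : J = (StdForm.antidiagonal 2).over ℂ)

include hJ in
/-- **(A0-c) HEAD, JOINT FORM — the same limit as ★ `exists_tendsto_abs_sub_smul_integral_descConj_hypBlockGL_cone` along the local chart `(x, θ) → (0, θ₀)` within `{x ≠ 0}`** (the wall value is a limit in ALL chart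
coordinates; the `hA0` slot of ★ `stOrbFamH_insert_cayPt_eq_mul_prod` ∕ (A0-DOCKED-JOINT) of LH10-p02 (g4)): for EVERY non-zero invariant Radon `μ` on `U(Φ₂)(ℂ) ⧸ T` ONE
`C₂ > 0` with, for every continuous compactly supported `f` and every `θ₀`,
**`|eˣ − e⁻ˣ| • ∫_{G ⧸ T} f(↑↑(y · hypBlockGL x θ · y⁻¹)) dμ(y) ⟶ C₂ • [cone⁺(f, e^{iθ₀}) + cone⁻(f, e^{iθ₀})]` along `𝓝[{x ≠ 0}] (0, θ₀)`** (★ joint (A0-b)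
`tendsto_abs_sub_smul_integral_descConj_hypBlockGL_joint` + the cone matching ★ `integral_addCircle_prod_coneChart_eq_two_smul_cone`). [cite: Varadarajan1989, §6.4 Lemma 21, Thm 23] [cite: Shelstad1979, Lemma 4.3 p. 25] [cite: Rogawski1990, §8.2 pp. 119, 122] -/
theorem exists_tendsto_abs_sub_smul_integral_descConj_hypBlockGL_cone_joint [Fact (0 < 2 * π)]
    [MeasurableSpace ↥(unitaryGroupOfForm (starRingEnd ℂ) J)] [BorelSpace ↥(unitaryGroupOfForm (starRingEnd ℂ) J)]
    [MeasurableSpace (↥(unitaryGroupOfForm (starRingEnd ℂ) J) ⧸ torusU (starRingEnd ℂ) J)]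
    [BorelSpace (↥(unitaryGroupOfForm (starRingEnd ℂ) J) ⧸ torusU (starRingEnd ℂ) J)]
    (μ : Measure (↥(unitaryGroupOfForm (starRingEnd ℂ) J) ⧸ torusU (starRingEnd ℂ) J))
    [SMulInvariantMeasure ↥(unitaryGroupOfForm (starRingEnd ℂ) J) (↥(unitaryGroupOfForm (starRingEnd ℂ) J) ⧸ torusU (starRingEnd ℂ) J) μ]
    [IsFiniteMeasureOnCompacts μ] (hμ : μ ≠ 0) {E : Type*} [NormedAddCommGroup E] [NormedSpace ℝ E] :
    ∃ C₂ : ℝ, 0 < C₂ ∧ ∀ (f : Matrix (Fin 2) (Fin 2) ℂ → E), Continuous f → HasCompactSupport f → ∀ θ : ℝ,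
      Tendsto (fun xθ : ℝ × ℝ => |Real.exp xθ.1 - Real.exp (-xθ.1)| •
          ∫ y, descConj (⟨hypBlockGL xθ.1 xθ.2, hypBlockGL_mem_of_eq_over hJ xθ.1 xθ.2⟩ : ↥(unitaryGroupOfForm (starRingEnd ℂ) J)) (torusU (starRingEnd ℂ) J)
            (LineRing.forall_mem_torusU_comm (starRingEnd ℂ) J (hypBlockGL_mem_torusU hJ xθ.1 xθ.2))
            (fun g : ↥(unitaryGroupOfForm (starRingEnd ℂ) J) => f ((g : GL (Fin 2) ℂ) : Matrix (Fin 2) (Fin 2) ℂ)) y ∂μ)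
        (𝓝[{xθ : ℝ × ℝ | xθ.1 ≠ 0}] (0, θ))
        (𝓝 (C₂ • ((∫ p in Ioi (0 : ℝ) ×ˢ Ioc (0 : ℝ) (2 * π),
            f ((!![(1 : ℂ), 1; 1, -1] : Matrix (Fin 2) (Fin 2) ℂ) *
              (Complex.exp ((θ : ℂ) * Complex.I) • (1 : Matrix (Fin 2) (Fin 2) ℂ) +
                p.1 • Matrix.diagonal ![Complex.exp ((θ : ℂ) * Complex.I) * Complex.I, -(Complex.exp ((θ : ℂ) * Complex.I) * Complex.I)] +
                p.1 • !![(0 : ℂ), -(Complex.exp ((θ : ℂ) * Complex.I) * Complex.I) * Complex.exp (-((p.2 : ℂ) * Complex.I));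
                  (Complex.exp ((θ : ℂ) * Complex.I) * Complex.I) * Complex.exp ((p.2 : ℂ) * Complex.I), 0]) *
              !![(1 / 2 : ℂ), 1 / 2; 1 / 2, -(1 / 2)])) +
          ∫ p in Ioi (0 : ℝ) ×ˢ Ioc (0 : ℝ) (2 * π),
            f ((!![(1 : ℂ), 1; 1, -1] : Matrix (Fin 2) (Fin 2) ℂ) *
              (Complex.exp ((θ : ℂ) * Complex.I) • (1 : Matrix (Fin 2) (Fin 2) ℂ) +
                p.1 • Matrix.diagonal ![-(Complex.exp ((θ : ℂ) * Complex.I) * Complex.I), Complex.exp ((θ : ℂ) * Complex.I) * Complex.I] +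
                p.1 • !![(0 : ℂ), (Complex.exp ((θ : ℂ) * Complex.I) * Complex.I) * Complex.exp (-((p.2 : ℂ) * Complex.I));
                  -(Complex.exp ((θ : ℂ) * Complex.I) * Complex.I) * Complex.exp ((p.2 : ℂ) * Complex.I), 0]) *
              !![(1 / 2 : ℂ), 1 / 2; 1 / 2, -(1 / 2)])))) := by
  -- instances on `G`, `T`, `N`
  haveI : LocallyCompactSpace ↥(unitaryGroupOfForm (starRingEnd ℂ) J) := locallyCompactSpace_unitaryGroupOfForm_complex J
  haveI : SecondCountableTopology ↥(unitaryGroupOfForm (starRingEnd ℂ) J) := secondCountableTopology_unitaryGroupOfForm_complex J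
  have hT : IsClosed (torusU (starRingEnd ℂ) J : Set ↥(unitaryGroupOfForm (starRingEnd ℂ) J)) := isClosed_torusU_two _ _
  have hN : IsClosed (unipotentU (starRingEnd ℂ) J : Set ↥(unitaryGroupOfForm (starRingEnd ℂ) J)) := isClosed_unipotentU _ _
  haveI : LocallyCompactSpace ↥(torusU (starRingEnd ℂ) J) := hT.isClosedEmbedding_subtypeVal.locallyCompactSpace
  haveI : LocallyCompactSpace ↥(unipotentU (starRingEnd ℂ) J) := hN.isClosedEmbedding_subtypeVal.locallyCompactSpace
  haveI : SecondCountableTopology ↥(unipotentU (starRingEnd ℂ) J) := TopologicalSpace.Subtype.secondCountableTopology _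
  haveI : BorelSpace ↥(torusU (starRingEnd ℂ) J) := Subtype.borelSpace _
  haveI : BorelSpace ↥(unipotentU (starRingEnd ℂ) J) := Subtype.borelSpace _
  -- the circle `K₁` as a subgroup, compact, with `G = K₁ · B`
  set ι : AddCircle (2 * π) → ↥(unitaryGroupOfForm (starRingEnd ℂ) J) :=
    fun s => ⟨archPlaneLiftGL 1 (rotMat s) (det_rotMat s), archPlaneLiftGL_rotMat_mem hJ s⟩ with hι
  have hιadd : ∀ s t, ι (s + t) = ι s * ι t := fun s t => Subtype.ext (archPlaneLiftGL_rotMat_add s t)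
  have hι0 : ι 0 = 1 := Subtype.ext archPlaneLiftGL_rotMat_zero
  have hιneg : ∀ s, ι (-s) = (ι s)⁻¹ := fun s => Subtype.ext (by
    rw [Subgroup.coe_inv]; exact archPlaneLiftGL_rotMat_neg s)
  let K : Subgroup ↥(unitaryGroupOfForm (starRingEnd ℂ) J) :=
    { carrier := Set.range ι
      one_mem' := ⟨0, hι0⟩
      mul_mem' := by
        rintro _ _ ⟨s, rfl⟩ ⟨t, rfl⟩
        exact ⟨s + t, hιadd s t⟩
      inv_mem' := by
        rintro _ ⟨s, rfl⟩
        exact ⟨-s, hιneg s⟩ }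
  have hKmem : ∀ s, ι s ∈ K := fun s => ⟨s, rfl⟩
  have hKmem' : ∀ k ∈ K, ∃ s, k = ι s := fun k ⟨s, hs⟩ => ⟨s, hs.symm⟩
  have hK : IsCompact (K : Set ↥(unitaryGroupOfForm (starRingEnd ℂ) J)) := isCompact_range_rotLift hJ
  have hKB : ∀ g : ↥(unitaryGroupOfForm (starRingEnd ℂ) J), ∃ k ∈ K, ∃ b ∈ borelU (starRingEnd ℂ) J, g = k * b := by
    intro g
    obtain ⟨s, b, hb, hg⟩ := exists_rotLift_mul_mem_borelU hJ g
    exact ⟨ι s, hKmem s, b, hb, hg⟩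
  haveI : CompactSpace ↥K := isCompact_iff_compactSpace.1 hK
  haveI : BorelSpace ↥K := Subtype.borelSpace _
  -- Haar measures: `κ` on `K₁` (image of `ds`), `μ_N` on `N` (image of `du`), `α` on `T`
  set ι' : AddCircle (2 * π) → ↥K := fun s => ⟨ι s, hKmem s⟩ with hι'
  have hι'c : Continuous ι' := (continuous_rotLift hJ).subtype_mk _
  set κ : Measure ↥K := Measure.map ι' volume with hκ
  haveI hκH : IsHaarMeasure κ := isHaarMeasure_map_rotLift hJ K hKmem hKmem'
  obtain ⟨ψ, hψc, hψadd, hψ01, hψH⟩ := exists_lineChart_real_isHaarMeasure_map hJ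
  set μN : Measure ↥(unipotentU (starRingEnd ℂ) J) := Measure.map ψ volume with hμN
  haveI : IsHaarMeasure μN := hψH
  set α : Measure ↥(torusU (starRingEnd ℂ) J) := Measure.haar with hα
  -- ★ FILE 1: the Iwasawa form of `μ`
  obtain ⟨C, hC0, hμC⟩ := exists_measure_quotient_torusU_complex_two_eq_smul_map hJ hK hKB κ α μN μ hμ
  have hCpos : (0 : ℝ) < (C : ℝ) := NNReal.coe_pos.2 (pos_iff_ne_zero.2 hC0)
  refine ⟨2 * (C : ℝ), by positivity, fun f hf hfc θ => ?_⟩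
  -- ★ FILE 2: the limit in `K × N` currency
  set F : ↥(unitaryGroupOfForm (starRingEnd ℂ) J) → E := fun g => f ((g : GL (Fin 2) ℂ) : Matrix (Fin 2) (Fin 2) ℂ) with hFdef
  have hF : Continuous F := hf.comp (Units.continuous_val.comp continuous_subtype_val)
  have hFc : HasCompactSupport F := hasCompactSupport_comp_coe hJ f hfc
  have hlim := tendsto_abs_sub_smul_integral_descConj_hypBlockGL_joint hJ κ μN μ hK hμC F hF hFc θ
  -- the value `∫_{K₁ × N} F(e^{iθ} · k n k⁻¹)` in the coordinates `(s, u)`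
  set z : ℂ := Complex.exp ((θ : ℂ) * Complex.I) with hz
  have hz0 : z ≠ 0 := Complex.exp_ne_zero _
  have hι'm : Measurable ι' := hι'c.measurable
  have hψm : Measurable ψ := hψc.measurable
  have hΦc : Continuous fun p : ↥K × ↥(unipotentU (starRingEnd ℂ) J) =>
      F ((⟨hypBlockGL 0 θ, hypBlockGL_mem_of_eq_over hJ 0 θ⟩ : ↥(unitaryGroupOfForm (starRingEnd ℂ) J)) *
        ((p.1 : ↥(unitaryGroupOfForm (starRingEnd ℂ) J)) * (p.2 : ↥(unitaryGroupOfForm (starRingEnd ℂ) J)) *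
          (p.1 : ↥(unitaryGroupOfForm (starRingEnd ℂ) J))⁻¹)) := by
    refine hF.comp (continuous_const.mul ?_)
    exact ((continuous_subtype_val.comp continuous_fst).mul (continuous_subtype_val.comp continuous_snd)).mul
      (continuous_subtype_val.comp continuous_fst).inv
  have hpt : ∀ (s : AddCircle (2 * π)) (u : ℝ),
      F ((⟨hypBlockGL 0 θ, hypBlockGL_mem_of_eq_over hJ 0 θ⟩ : ↥(unitaryGroupOfForm (starRingEnd ℂ) J)) *
        (((ι' s : ↥K) : ↥(unitaryGroupOfForm (starRingEnd ℂ) J)) * ((ψ u : ↥(unipotentU (starRingEnd ℂ) J)) : ↥(unitaryGroupOfForm (starRingEnd ℂ) J)) *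
          ((ι' s : ↥K) : ↥(unitaryGroupOfForm (starRingEnd ℂ) J))⁻¹)) =
      f (z • ((1 : Matrix (Fin 2) (Fin 2) ℂ) + (((u : ℝ) : ℂ) * Complex.I) •
        !![Complex.I * ((Real.Angle.sin s : ℝ) : ℂ) * ((Real.Angle.cos s : ℝ) : ℂ), ((Real.Angle.cos s : ℝ) : ℂ) ^ 2;
          ((Real.Angle.sin s : ℝ) : ℂ) ^ 2, -(Complex.I * ((Real.Angle.sin s : ℝ) : ℂ) * ((Real.Angle.cos s : ℝ) : ℂ))])) := by
    intro s u
    simp only [hFdef]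
    rw [Subgroup.coe_mul, Units.val_mul, coe_hypBlockGL_zero_left, Matrix.smul_mul, Matrix.one_mul]
    change f (z • ((((ι s * ((ψ u : ↥(unipotentU (starRingEnd ℂ) J)) : ↥(unitaryGroupOfForm (starRingEnd ℂ) J)) * (ι s)⁻¹ :
      ↥(unitaryGroupOfForm (starRingEnd ℂ) J)) : GL (Fin 2) ℂ) : Matrix (Fin 2) (Fin 2) ℂ))) = _
    rw [hι, coe_rotLift_mul_unipotent_mul_inv hJ s (ψ u), hψ01]
  have hV : ∫ p : ↥K × ↥(unipotentU (starRingEnd ℂ) J),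
      F ((⟨hypBlockGL 0 θ, hypBlockGL_mem_of_eq_over hJ 0 θ⟩ : ↥(unitaryGroupOfForm (starRingEnd ℂ) J)) *
        ((p.1 : ↥(unitaryGroupOfForm (starRingEnd ℂ) J)) * (p.2 : ↥(unitaryGroupOfForm (starRingEnd ℂ) J)) *
          (p.1 : ↥(unitaryGroupOfForm (starRingEnd ℂ) J))⁻¹)) ∂(κ.prod μN) =
      ∫ q : AddCircle (2 * π) × ℝ, f (z • ((1 : Matrix (Fin 2) (Fin 2) ℂ) + (((q.2 : ℝ) : ℂ) * Complex.I) •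
        !![Complex.I * ((Real.Angle.sin q.1 : ℝ) : ℂ) * ((Real.Angle.cos q.1 : ℝ) : ℂ), ((Real.Angle.cos q.1 : ℝ) : ℂ) ^ 2;
          ((Real.Angle.sin q.1 : ℝ) : ℂ) ^ 2, -(Complex.I * ((Real.Angle.sin q.1 : ℝ) : ℂ) * ((Real.Angle.cos q.1 : ℝ) : ℂ))])) ∂(volume.prod volume) := by
    rw [hκ, hμN, Measure.map_prod_map _ _ hι'm hψm, integral_map (hι'm.prodMap hψm).aemeasurable hΦc.aestronglyMeasurable]
    refine integral_congr_ae (Eventually.of_forall fun q => ?_)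
    exact hpt q.1 q.2
  rw [hV, integral_addCircle_prod_coneChart_eq_two_smul_cone f hf hfc z hz0, smul_smul, mul_comm (C : ℝ) 2] at hlim
  exact hlim

end ConeMatchingJoint

end UnitaryGroup

end Literature.NumberTheory.Automorphic

end
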